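import Mathlib.Analysis.ODE.Gronwall
import Mathlib.Analysis.Calculus.FDeriv.Symmetric
import Mathlib.Analysis.Calculus.DifferentialForm.Basic
import Mathlib.Analysis.Calculus.ContDiff.Operations
import HarnessLib

/-!
# Pfaffian equations invariant under a flow: the linearised (variational) form

Topic `Literature/Analysis/ODE`; chart-level infrastructure for Gray-type transport statements
on manifolds (fact seat of `Literature.Geometry.Symplectic.Gompf1998_thm13_twoHandles`: the flow
of the normalised Liouville field of a Stein domain carries the complex tangencies of one level
of `φ` onto those of the other levels).  Everything is **proved**; no named fact.

Setting (a chart): `E` a real normed space, `s ⊆ E` the set within which derivatives are taken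
(in the applications the trace of a ball on a closed half-space: convex, with the
unique-differentiability property), a vector field `Z : E → E`, a solution `u : [0, T] → s` of
`u' = Z(u)` (Mathlib's closed-interval convention: one-sided derivatives at the ends), and a
solution `J : [0, T] → (E →L E)` of the **linearised (variational) equation**
`J' = DZ(u(t)) ∘ J` along `u`.  For the flow `u(t) = Fl_t(y)` of `Z`, `J(t) = D(Fl_t)(y)` is
such a solution (Lang 1995, Ch. IV §1, Thm. 1.14 and formula (5): `D₁D₂α = Df(α) D₂α`; in the
tree `Literature.Analysis.ODE.IsSolutionFamily.hasFDerivWithinAt`, `FlowWithin.lean`).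

* `eq_zero_of_norm_deriv_le_mul` — Grönwall: `‖g'‖ ≤ K ‖g‖` on `[a, b)` and `g(a) = 0` force
  `g ≡ 0` on `[a, b]`.
* `apply_linearization_eq_zero` — **a field of linear maps `Λ : E → (E →L F)` whose Lie
  derivative along `Z` is pointwise a multiple of itself is carried along the linearised
  flow**: if `(D_{Z q} Λ)(q) w + Λ(q)(DZ(q) w) = C(q) (Λ(q) w)` for `q ∈ s` — the coordinate
  expression of `L_Z Λ = C ∘ Λ` — then `Λ(u 0)(J 0 v) = 0` implies `Λ(u t)(J t v) = 0` on
  `[0, T]`: `g(t) = Λ(u t)(J t v)` solves the linear equation `g' = C(u t) g` (chain and product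
  rules), so Grönwall applies.  This is the infinitesimal form of "the flow of `Z` preserves the
  distribution `ker Λ`" (a Pfaffian system `Λ = 0` with `L_Z Λ ≡ 0 mod Λ` is invariant under the
  flow of `Z`).  `apply_linearization_eq` — the case `C = 0`: `Λ(u t)(J t v)` is constant.
* `extDerivWithin_apply_eq_lie` — **Cartan's formula for a `1`-form annihilating the field, in
  coordinates**: if `ω(q)(Z q) = 0` on `s` then
  `dω(q)(Z q, w) = (D_{Z q} ω)(q)(w) + ω(q)(DZ(q) w)` (`= (L_Z ω)(q)(w)`, the term `d(ω(Z))`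
  of `L_Z = ι_Z d + d ι_Z` being absent), in Mathlib's normalisation
  `dω(a, b) = Dω(a)(b) - Dω(b)(a)` of `extDerivWithin` (Lee 2013, Thm. 14.35 for the
  invariant formula).
* `lie_fderivWithin_apply_eq_zero` — for a `C²` function `Φ` with `dΦ(Z) ≡ 1` on `s`:
  `(D_{Z q} dΦ)(q)(w) + dΦ(q)(DZ(q) w) = 0` (`L_Z dΦ = d(dΦ(Z)) = 0`; symmetry of second
  derivatives within `s`, `ContDiffWithinAt.isSymmSndFDerivWithinAt`).
* The two transport statements used downstream: `oneForm_apply_linearization_eq_zero`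
  (`ω(u 0)(J 0 v) = 0 → ω(u t)(J t v) = 0` when `ω(Z) ≡ 0` and `ι_Z dω = c • ω` on `s`) and
  `fderivWithin_apply_linearization_eq` (`dΦ(u t)(J t v) = dΦ(u 0)(J 0 v)` when `dΦ(Z) ≡ 1`).

## References

* S. Lang, *Differential and Riemannian Manifolds*, GTM 160 (1995), Ch. IV §1 (the linearised
  equation, Thm. 1.14) and Ch. V §1–§2 (Lie derivative, `L_X = ι_X d + d ι_X`). [Lang1995]
* J. M. Lee, *Introduction to Smooth Manifolds*, 2nd ed., GTM 218 (2013), Thm. 14.35 (Cartan's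
  magic formula), Ch. 19 (Pfaffian systems / distributions defined by forms). [LeeSmoothManifolds2013]
-/

noncomputable section

open Set Filter Metric
open scoped Topology NNReal

namespace Literature.Analysis.ODE

variable {E : Type*} [NormedAddCommGroup E] [NormedSpace ℝ E]
  {F : Type*} [NormedAddCommGroup F] [NormedSpace ℝ F]

/-! ### Grönwall: a linear differential inequality with zero initial value -/

/-- **Grönwall, homogeneous case.**  If `g` is continuous on `[a, b]`, right-differentiable on
`[a, b)` with `‖g'‖ ≤ K ‖g‖`, and `g a = 0`, then `g ≡ 0` on `[a, b]`
(`norm_le_gronwallBound_of_norm_deriv_right_le` with `δ = ε = 0`). [folklore] -/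
theorem eq_zero_of_norm_deriv_le_mul {g g' : ℝ → F} {a b K : ℝ}
    (hg : ContinuousOn g (Icc a b)) (hg' : ∀ t ∈ Ico a b, HasDerivWithinAt g (g' t) (Ici t) t)
    (h0 : g a = 0) (hbound : ∀ t ∈ Ico a b, ‖g' t‖ ≤ K * ‖g t‖) :
    ∀ t ∈ Icc a b, g t = 0 := by
  intro t ht
  have h := norm_le_gronwallBound_of_norm_deriv_right_le (δ := 0) (ε := 0) hg hg'
    (by rw [h0, norm_zero]) (fun t ht => by rw [add_zero]; exact hbound t ht) t ht
  rw [gronwallBound_ε0_δ0] at h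
  exact norm_le_zero_iff.1 h

/-- One-sided derivatives on `[0, T]` from derivatives within `[0, T]`. [folklore] -/
theorem hasDerivWithinAt_Ici_of_Icc {g : ℝ → F} {g' : F} {T t : ℝ}
    (h : HasDerivWithinAt g g' (Icc 0 T) t) (ht : t ∈ Ico 0 T) : HasDerivWithinAt g g' (Ici t) t :=
  h.mono_of_mem_nhdsWithin (mem_of_superset (Icc_mem_nhdsGE ht.2) (Icc_subset_Icc ht.1 le_rfl))

/-! ### Transport of a field of linear maps along the linearised flow -/

section Linear

variable {Λ : E → E →L[ℝ] F} {Λ' : E → E →L[ℝ] E →L[ℝ] F} {Z : E → E} {Z' : E → E →L[ℝ] E}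
  {s : Set E} {T : ℝ} {u : ℝ → E} {J : ℝ → E →L[ℝ] E}

/-- **The derivative of `t ↦ Λ(u t)(J t v)` along a solution and its linearisation**:
`(D_{Z(u t)} Λ)(u t)(J t v) + Λ(u t)(DZ(u t)(J t v))` (chain rule for `Λ ∘ u`, product rule for
the evaluation). [cite: Lang1995, Ch. IV §1, Thm. 1.14] -/
theorem hasDerivWithinAt_apply_linearization
    (hΛ : ∀ q ∈ s, HasFDerivWithinAt Λ (Λ' q) s q)
    (hu : ∀ t ∈ Icc 0 T, HasDerivWithinAt u (Z (u t)) (Icc 0 T) t)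
    (hus : ∀ t ∈ Icc 0 T, u t ∈ s)
    (hJ : ∀ t ∈ Icc 0 T, HasDerivWithinAt J ((Z' (u t)).comp (J t)) (Icc 0 T) t)
    (v : E) {t : ℝ} (ht : t ∈ Icc 0 T) :
    HasDerivWithinAt (fun t => Λ (u t) (J t v))
      (Λ' (u t) (Z (u t)) (J t v) + Λ (u t) (Z' (u t) (J t v))) (Icc 0 T) t := by
  have h1 : HasDerivWithinAt (fun t => Λ (u t)) (Λ' (u t) (Z (u t))) (Icc 0 T) t :=
    (hΛ _ (hus t ht)).comp_hasDerivWithinAt t (hu t ht) fun t' ht' => hus t' ht'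
  have h2 : HasDerivWithinAt (fun t => J t v) ((Z' (u t)).comp (J t) v) (Icc 0 T) t := by
    have h := (hJ t ht).clm_apply (hasDerivWithinAt_const t (Icc 0 T) v)
    simpa using h
  have h3 := h1.clm_apply h2
  simpa using h3

/-- **Transport of a field of linear maps along the linearised flow.**  Let `u` solve
`u' = Z(u)` on `[0, T]` inside `s`, let `J` solve the linearised equation `J' = DZ(u t) ∘ J`,
and let `Λ : E → (E →L F)` be differentiable within `s` with
`(D_{Z q} Λ)(q) w + Λ(q)(DZ(q) w) = C(q)(Λ(q) w)` for `q ∈ s` (the Lie derivative of `Λ` along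
`Z` is `C ∘ Λ`), `‖C‖ ≤ K` along the trajectory.  If `Λ(u 0)(J 0 v) = 0` then
`Λ(u t)(J t v) = 0` for all `t ∈ [0, T]`: `g(t) = Λ(u t)(J t v)` solves `g' = C(u t) g`,
`g(0) = 0` (Grönwall).  With `J t = D(Fl_t)` this says that the flow of `Z` maps `ker Λ(y)`
into `ker Λ(Fl_t y)`. [cite: Lang1995, Ch. IV §1, Thm. 1.14] -/
theorem apply_linearization_eq_zero {C : E → F →L[ℝ] F} {K : ℝ}
    (hΛ : ∀ q ∈ s, HasFDerivWithinAt Λ (Λ' q) s q)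
    (hlie : ∀ q ∈ s, ∀ w, Λ' q (Z q) w + Λ q (Z' q w) = C q (Λ q w))
    (hu : ∀ t ∈ Icc 0 T, HasDerivWithinAt u (Z (u t)) (Icc 0 T) t)
    (hus : ∀ t ∈ Icc 0 T, u t ∈ s)
    (hJ : ∀ t ∈ Icc 0 T, HasDerivWithinAt J ((Z' (u t)).comp (J t)) (Icc 0 T) t)
    (hC : ∀ t ∈ Icc 0 T, ‖C (u t)‖ ≤ K) {v : E} (h0 : Λ (u 0) (J 0 v) = 0) :
    ∀ t ∈ Icc 0 T, Λ (u t) (J t v) = 0 := by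
  have hder : ∀ t ∈ Icc 0 T, HasDerivWithinAt (fun t => Λ (u t) (J t v))
      (C (u t) (Λ (u t) (J t v))) (Icc 0 T) t := fun t ht => by
    have h := hasDerivWithinAt_apply_linearization hΛ hu hus hJ v ht
    rwa [hlie _ (hus t ht)] at h
  refine eq_zero_of_norm_deriv_le_mul (K := K) (fun t ht => (hder t ht).continuousWithinAt)
    (fun t ht => hasDerivWithinAt_Ici_of_Icc (hder t (Ico_subset_Icc_self ht)) ht) h0
    fun t ht => ?_
  exact ((C (u t)).le_opNorm _).trans
    (mul_le_mul_of_nonneg_right (hC t (Ico_subset_Icc_self ht)) (norm_nonneg _))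

/-- **The case `L_Z Λ = 0`: `Λ(u t)(J t v)` is constant along the linearised flow.**
[cite: Lang1995, Ch. IV §1, Thm. 1.14] -/
theorem apply_linearization_eq
    (hΛ : ∀ q ∈ s, HasFDerivWithinAt Λ (Λ' q) s q)
    (hlie : ∀ q ∈ s, ∀ w, Λ' q (Z q) w + Λ q (Z' q w) = 0)
    (hu : ∀ t ∈ Icc 0 T, HasDerivWithinAt u (Z (u t)) (Icc 0 T) t)
    (hus : ∀ t ∈ Icc 0 T, u t ∈ s)
    (hJ : ∀ t ∈ Icc 0 T, HasDerivWithinAt J ((Z' (u t)).comp (J t)) (Icc 0 T) t)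
    (v : E) : ∀ t ∈ Icc 0 T, Λ (u t) (J t v) = Λ (u 0) (J 0 v) := by
  have hder : ∀ t ∈ Icc 0 T, HasDerivWithinAt (fun t => Λ (u t) (J t v) - Λ (u 0) (J 0 v))
      (0 : F) (Icc 0 T) t := fun t ht => by
    have h := hasDerivWithinAt_apply_linearization hΛ hu hus hJ v ht
    rw [hlie _ (hus t ht)] at h
    simpa using h.sub_const (Λ (u 0) (J 0 v))
  intro t ht
  have h := eq_zero_of_norm_deriv_le_mul (K := 0) (g' := fun _ => (0 : F))
    (fun t ht => (hder t ht).continuousWithinAt)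
    (fun t ht => hasDerivWithinAt_Ici_of_Icc (hder t (Ico_subset_Icc_self ht)) ht)
    (sub_self _) (fun t _ => by simp) t ht
  exact sub_eq_zero.1 h

end Linear

/-! ### Cartan's formula in coordinates for a `1`-form annihilating the field -/

section OneForm

variable {ω : E → E [⋀^Fin 1]→L[ℝ] F} {Z : E → E} {s : Set E} {q : E}

omit [NormedAddCommGroup E] [NormedSpace ℝ E] in
/-- `Fin.removeNth` on a pair: removing the first entry leaves the second. [folklore] -/
theorem removeNth_zero_pair (a b : E) : Fin.removeNth (0 : Fin 2) ![a, b] = ![b] := by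
  funext i
  fin_cases i
  rfl

omit [NormedAddCommGroup E] [NormedSpace ℝ E] in
/-- `Fin.removeNth` on a pair: removing the second entry leaves the first. [folklore] -/
theorem removeNth_one_pair (a b : E) : Fin.removeNth (1 : Fin 2) ![a, b] = ![a] := by
  funext i
  fin_cases i
  rfl

/-- Mathlib's exterior derivative of a `1`-form on a pair of vectors:
`dω(q)(a, b) = (D_a ω)(q)(b) - (D_b ω)(q)(a)`. [folklore] -/
theorem extDerivWithin_apply_pair (hω : DifferentiableWithinAt ℝ ω s q)
    (hs : UniqueDiffWithinAt ℝ s q) (a b : E) :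
    extDerivWithin ω s q ![a, b] =
      fderivWithin ℝ ω s q a ![b] - fderivWithin ℝ ω s q b ![a] := by
  rw [extDerivWithin_apply hω hs, Fin.sum_univ_two]
  simp only [Fin.val_zero, pow_zero, one_smul, Matrix.cons_val_zero, Fin.val_one, pow_one,
    neg_smul, Matrix.cons_val_one, Matrix.cons_val_fin_one]
  rw [removeNth_zero_pair, removeNth_one_pair,
    fderivWithin_continuousAlternatingMap_apply_const hs hω,
    fderivWithin_continuousAlternatingMap_apply_const hs hω]
  simp [sub_eq_add_neg]

/-- **The derivative of `q ↦ ω(q)(Z q)`**: `(D_w ω)(q)(Z q) + ω(q)(DZ(q) w)` (Mathlib's product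
rule `HasFDerivWithinAt.continuousAlternatingMap_apply`, one vector argument). [folklore] -/
theorem hasFDerivWithinAt_oneForm_apply_field {ω' : E →L[ℝ] E [⋀^Fin 1]→L[ℝ] F}
    {Z' : E →L[ℝ] E} (hω : HasFDerivWithinAt ω ω' s q) (hZ : HasFDerivWithinAt Z Z' s q) :
    HasFDerivWithinAt (fun q => ω q fun _ : Fin 1 => Z q)
      (ContinuousAlternatingMap.apply ℝ E F (fun _ : Fin 1 => Z q) ∘L ω' +
        (ω q).toContinuousLinearMap (fun _ : Fin 1 => Z q) 0 ∘L Z') s q := by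
  have h := hω.continuousAlternatingMap_apply (g := fun (_ : Fin 1) q => Z q)
    (g' := fun _ => Z') (fun _ => hZ)
  simp only [Finset.univ_unique, Fin.default_eq_zero, Finset.sum_singleton] at h
  exact h

/-- **Cartan's formula for a `1`-form annihilating the field, in coordinates.**  If
`ω(q')(Z q') = 0` for all `q' ∈ s`, then for `q ∈ s`,
`dω(q)(Z q, w) = (D_{Z q} ω)(q)(w) + ω(q)(DZ(q) w)`: by `extDerivWithin_apply_pair`,
`dω(Z, w) = D_Z ω (w) - D_w ω (Z)`, and differentiating `ω(Z) ≡ 0` along `w` within `s` gives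
`D_w ω (Z) + ω (DZ w) = 0`.  The right-hand side is the coordinate expression of the Lie
derivative `(L_Z ω)(w)`; this is `L_Z = ι_Z d + d ι_Z` on `1`-forms with `ι_Z ω = 0`.
[cite: LeeSmoothManifolds2013, Thm. 14.35] -/
theorem extDerivWithin_apply_eq_lie {ω' : E →L[ℝ] E [⋀^Fin 1]→L[ℝ] F} {Z' : E →L[ℝ] E}
    (hω : HasFDerivWithinAt ω ω' s q) (hZ : HasFDerivWithinAt Z Z' s q)
    (hs : UniqueDiffWithinAt ℝ s q) (hq : q ∈ s) (h0 : ∀ q' ∈ s, ω q' ![Z q'] = 0) (w : E) :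
    extDerivWithin ω s q ![Z q, w] = ω' (Z q) ![w] + ω q ![Z' w] := by
  rw [extDerivWithin_apply_pair hω.differentiableWithinAt hs, hω.fderivWithin hs]
  -- differentiate `ω(Z) ≡ 0`
  have h0' : ∀ q' ∈ s, (ω q' fun _ : Fin 1 => Z q') = 0 := fun q' hq' => by
    rw [← Matrix.vec_single_eq_const]; exact h0 q' hq'
  have h1 := hasFDerivWithinAt_oneForm_apply_field hω hZ
  have h2 : HasFDerivWithinAt (fun q' => ω q' fun _ : Fin 1 => Z q') (0 : E →L[ℝ] F) s q :=
    (hasFDerivWithinAt_const (0 : F) q s).congr (fun q' hq' => h0' q' hq') (h0' q hq)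
  have h3 := hs.eq h1 h2
  have h4 := DFunLike.congr_fun h3 w
  simp only [add_apply, ContinuousLinearMap.coe_comp, Function.comp_apply,
    ContinuousAlternatingMap.apply_apply, zero_apply] at h4
  -- `(ω q).toContinuousLinearMap (fun _ => Z q) 0 (Z' w) = ω q ![Z' w]`
  have h5 : (ω q).toContinuousLinearMap (fun _ : Fin 1 => Z q) 0 (Z' w) = ω q ![Z' w] := by
    rw [ContinuousAlternatingMap.toContinuousLinearMap,
      ContinuousMultilinearMap.toContinuousLinearMap_apply]
    show ω q (Function.update (fun _ : Fin 1 => Z q) 0 (Z' w)) = ω q ![Z' w]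
    congr 1
    funext i
    fin_cases i
    rfl
  have h6 : ω' w (fun _ : Fin 1 => Z q) = ω' w ![Z q] := by
    rw [← Matrix.vec_single_eq_const]
  rw [h5, h6] at h4
  -- `h4 : ω' w ![Z q] + ω q ![Z' w] = 0`
  have h7 : ω' w ![Z q] = -ω q ![Z' w] := eq_neg_of_add_eq_zero_left h4
  rw [h7]
  abel

/-- **Transport of a `1`-form annihilating the field whose contraction into `dω` is a multiple
of the form.**  If `ω(Z) ≡ 0` on `s` and `dω(q)(Z q, w) = c(q) ω(q)(w)` (`ι_Z dω = c ω`, so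
`L_Z ω = c ω`), `|c| ≤ K` along the trajectory, then `ω(u 0)(J 0 v) = 0` implies
`ω(u t)(J t v) = 0` on `[0, T]` (`apply_linearization_eq_zero` for `Λ(q)(w) = ω(q)(w)`).
[cite: Lang1995, Ch. IV §1, Thm. 1.14] -/
theorem oneForm_apply_linearization_eq_zero {c : E → ℝ} {K T : ℝ} {u : ℝ → E}
    {J : ℝ → E →L[ℝ] E} {Z' : E → E →L[ℝ] E}
    (hω : DifferentiableOn ℝ ω s) (hZ : ∀ q ∈ s, HasFDerivWithinAt Z (Z' q) s q)
    (hs : UniqueDiffOn ℝ s) (h0 : ∀ q ∈ s, ω q ![Z q] = 0)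
    (hd : ∀ q ∈ s, ∀ w, extDerivWithin ω s q ![Z q, w] = c q • ω q ![w])
    (hu : ∀ t ∈ Icc 0 T, HasDerivWithinAt u (Z (u t)) (Icc 0 T) t)
    (hus : ∀ t ∈ Icc 0 T, u t ∈ s)
    (hJ : ∀ t ∈ Icc 0 T, HasDerivWithinAt J ((Z' (u t)).comp (J t)) (Icc 0 T) t)
    (hc : ∀ t ∈ Icc 0 T, |c (u t)| ≤ K) {v : E} (hv : ω (u 0) ![J 0 v] = 0) :
    ∀ t ∈ Icc 0 T, ω (u t) ![J t v] = 0 := by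
  -- the field of linear maps `Λ q w = ω q ![w]`, through the isometry `ofSubsingletonLIE`
  set L : (E [⋀^Fin 1]→L[ℝ] F) ≃L[ℝ] (E →L[ℝ] F) :=
    (ContinuousAlternatingMap.ofSubsingletonLIE (𝕜 := ℝ) (E := E) (F := F)
      (0 : Fin 1)).symm.toContinuousLinearEquiv with hL
  have hLapply : ∀ (α : E [⋀^Fin 1]→L[ℝ] F) (w : E), L α w = α ![w] := fun α w => by
    have h1 : (ContinuousAlternatingMap.ofSubsingletonLIE (𝕜 := ℝ) (E := E) (F := F)
        (0 : Fin 1)) (L α) = α := by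
      rw [hL]
      exact LinearIsometryEquiv.apply_symm_apply _ α
    have h2 := congrArg (fun β : E [⋀^Fin 1]→L[ℝ] F => β ![w]) h1
    rw [← h2]
    rfl
  set Λ : E → E →L[ℝ] F := fun q => L (ω q) with hΛ
  set Λ' : E → E →L[ℝ] E →L[ℝ] F := fun q => (L : (E [⋀^Fin 1]→L[ℝ] F) →L[ℝ] E →L[ℝ] F).comp
    (fderivWithin ℝ ω s q) with hΛ'
  have hΛd : ∀ q ∈ s, HasFDerivWithinAt Λ (Λ' q) s q := fun q hq =>
    (L : (E [⋀^Fin 1]→L[ℝ] F) →L[ℝ] E →L[ℝ] F).hasFDerivAt.comp_hasFDerivWithinAt q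
      (hω q hq).hasFDerivWithinAt
  set C : E → F →L[ℝ] F := fun q => c q • ContinuousLinearMap.id ℝ F with hC
  have hlie : ∀ q ∈ s, ∀ w, Λ' q (Z q) w + Λ q (Z' q w) = C q (Λ q w) := fun q hq w => by
    simp only [hΛ', hΛ, hC, ContinuousLinearMap.coe_comp, Function.comp_apply,
      ContinuousLinearEquiv.coe_coe, hLapply, smul_apply,
      ContinuousLinearMap.id_apply]
    rw [← hd q hq w, extDerivWithin_apply_eq_lie (hω q hq).hasFDerivWithinAt (hZ q hq) (hs q hq)
      hq h0 w]
  have hCK : ∀ t ∈ Icc 0 T, ‖C (u t)‖ ≤ K := fun t ht => by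
    simp only [hC]
    calc ‖c (u t) • ContinuousLinearMap.id ℝ F‖
        ≤ ‖c (u t)‖ * ‖ContinuousLinearMap.id ℝ F‖ := ContinuousLinearMap.opNorm_smul_le (c (u t)) _
      _ ≤ ‖c (u t)‖ := mul_le_of_le_one_right (norm_nonneg _) ContinuousLinearMap.norm_id_le
      _ ≤ K := by rw [Real.norm_eq_abs]; exact hc t ht
  have h := apply_linearization_eq_zero hΛd hlie hu hus hJ hCK (v := v)
    (by simp only [hΛ, hLapply]; exact hv)
  intro t ht
  have h' := h t ht
  simp only [hΛ, hLapply] at h'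
  exact h'

end OneForm

/-! ### The differential of a function on which the field acts as `1` -/

section LevelFunction

variable {Φ : E → ℝ} {Z : E → E} {s : Set E} {q : E}

/-- **`L_Z dΦ = 0` in coordinates when `dΦ(Z) ≡ 1`.**  For `Φ` of class `C²` within `s` at
`q ∈ s` (with `s` uniquely differentiable and `q ∈ closure (interior s)`) and
`dΦ(q')(Z q') = 1` for `q' ∈ s`:  `(D_{Z q} dΦ)(q)(w) + dΦ(q)(DZ(q) w) = 0` — the second
derivative is symmetric (`ContDiffWithinAt.isSymmSndFDerivWithinAt`) and the derivative of the
constant function `q' ↦ dΦ(q')(Z q')` vanishes. [folklore] -/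
theorem lie_fderivWithin_apply_eq_zero {Z' : E →L[ℝ] E} (hΦ : ContDiffWithinAt ℝ 2 Φ s q)
    (hΦ' : HasFDerivWithinAt (fderivWithin ℝ Φ s) (fderivWithin ℝ (fderivWithin ℝ Φ s) s q) s q)
    (hZ : HasFDerivWithinAt Z Z' s q) (hs : UniqueDiffOn ℝ s) (hq : q ∈ closure (interior s))
    (hqs : q ∈ s) (h1 : ∀ q' ∈ s, fderivWithin ℝ Φ s q' (Z q') = 1) (w : E) :
    fderivWithin ℝ (fderivWithin ℝ Φ s) s q (Z q) w + fderivWithin ℝ Φ s q (Z' w) = 0 := by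
  have hsymm : fderivWithin ℝ (fderivWithin ℝ Φ s) s q (Z q) w =
      fderivWithin ℝ (fderivWithin ℝ Φ s) s q w (Z q) :=
    hΦ.isSymmSndFDerivWithinAt (by simp) hs hq hqs (Z q) w
  rw [hsymm]
  -- differentiate the constant function `q' ↦ dΦ(q')(Z q')`
  have h2 := hΦ'.clm_apply hZ
  have h3 : HasFDerivWithinAt (fun q' => fderivWithin ℝ Φ s q' (Z q')) (0 : E →L[ℝ] ℝ) s q :=
    (hasFDerivWithinAt_const (1 : ℝ) q s).congr (fun q' hq' => h1 q' hq') (h1 q hqs)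
  have h4 := DFunLike.congr_fun ((hs q hqs).eq h2 h3) w
  simp only [add_apply, ContinuousLinearMap.coe_comp, Function.comp_apply,
    ContinuousLinearMap.flip_apply, zero_apply] at h4
  linarith

/-- **The differential of a level-type function is transported along the linearised flow.**  If
`Φ` is `C²` on `s` (convex-like: `s ⊆ closure (interior s)`, uniquely differentiable),
`dΦ(Z) ≡ 1` on `s`, `u` solves `u' = Z(u)` in `s` and `J` the linearised equation along `u`,
then `dΦ(u t)(J t v) = dΦ(u 0)(J 0 v)` on `[0, T]`; in particular the flow of `Z` maps
`ker dΦ` to `ker dΦ` (it maps levels of `Φ` to levels of `Φ`). [cite: Lang1995, Ch. IV §1, Thm. 1.14] -/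
theorem fderivWithin_apply_linearization_eq {T : ℝ} {u : ℝ → E} {J : ℝ → E →L[ℝ] E}
    {Z' : E → E →L[ℝ] E} (hΦ : ContDiffOn ℝ 2 Φ s)
    (hZ : ∀ q ∈ s, HasFDerivWithinAt Z (Z' q) s q) (hs : UniqueDiffOn ℝ s)
    (hcl : s ⊆ closure (interior s)) (h1 : ∀ q' ∈ s, fderivWithin ℝ Φ s q' (Z q') = 1)
    (hu : ∀ t ∈ Icc 0 T, HasDerivWithinAt u (Z (u t)) (Icc 0 T) t)
    (hus : ∀ t ∈ Icc 0 T, u t ∈ s)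
    (hJ : ∀ t ∈ Icc 0 T, HasDerivWithinAt J ((Z' (u t)).comp (J t)) (Icc 0 T) t) (v : E) :
    ∀ t ∈ Icc 0 T, fderivWithin ℝ Φ s (u t) (J t v) = fderivWithin ℝ Φ s (u 0) (J 0 v) := by
  have hΦ' : ∀ q ∈ s, HasFDerivWithinAt (fderivWithin ℝ Φ s)
      (fderivWithin ℝ (fderivWithin ℝ Φ s) s q) s q := fun q hq =>
    ((hΦ.fderivWithin hs (by norm_num : (1 : WithTop ℕ∞) + 1 ≤ 2)).differentiableOn
      (by norm_num) q hq).hasFDerivWithinAt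
  exact apply_linearization_eq (Λ := fderivWithin ℝ Φ s)
    (Λ' := fun q => fderivWithin ℝ (fderivWithin ℝ Φ s) s q) hΦ'
    (fun q hq w => lie_fderivWithin_apply_eq_zero (hΦ q hq) (hΦ' q hq) (hZ q hq) hs (hcl hq) hq
      h1 w) hu hus hJ v

end LevelFunction

end Literature.Analysis.ODE

end
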